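import Summits.CriticalPhenomena.PercolationContinuityZ3.Theorems.PercNearOneGluingNoHeavyLowerTailSahiCombMixAtomsFive
import Summits.CriticalPhenomena.PercolationContinuityZ3.Theorems.PercNearOneGluingNoHeavyLowerTailSahiMixtureTopFive
import Summits.CriticalPhenomena.PercolationContinuityZ3.Theorems.PercNearOneGluingNoHeavyLowerTailSahiCombMixFiveSingle

/-!
# The comb (tensor-Bernstein) hierarchy for Sahi's `E_k`, LXXVI: comb TOP(5) and the `|G| = 5` rung of comb H-MIX(5) — OR-ing a fresh coordinate into
# ALL FIVE events preserves the hereditary comb class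

Support file of the one-cut programme (crux `NoHeavyLowerTail`, stmt-CriticalPhenomena-4575; cell `prim-masterthm`, seat P3, gen 12;
`run/shared/lean/prim/prim-masterthm/prim-masterthm-p3/HIERARCHY.md` §20).  Cube version of gen 6's law-level TOP(5) defect form
`SahiMixture.sahiE_five_orCoin_top_eq` (`…SahiMixtureTopFive`): with `h = p_e`,
`E_5(U_0∪[e],…,U_4∪[e]) = h(1−h)·T₁ + (1−h)²·E_5(U) + h(1−h)²·N₃ + h(1−h)²(2−h)·N₄ + h(1−h)²(1+(1−h)+(1−h)²)·N₅`,
every piece a product of at most five moments of nonnegative functions of the `U_j` (comb-positive at multidegree `1` off `e`) or the hereditary comb row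
`E_5(U)`; the transfer `sahiE_orCoord_eq_coin` (`…SahiCombMixCoinTransfer`) moves the cube cell to the coin cell.  The TOP(5) part is generated by the seat
script `code/lean/gen_top5.py`.
* `combPos_ex_sub_off` — `μ_p(f) − μ_p(g)` for `g ≤ f` ignoring `e` is comb-positive at multidegree `1` off `e`;
* `combPos_atMostThree_five` — `T₁/6 = μ_p(|{j : ω ∈ U_j}| ≤ 3)`;
* **`combPos_five_orCoord_all`** — for five events ignoring `e` whose ∩-closed family is comb-positive at every order (only the row `E_5(U)` is used), the top row of
  `(U_j ∪ {e ∈ ω})_j` is comb-positive at multidegree `5`;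
* `biInter_orCoord_all` — members of the ∩-closed family of the all-OR-ed family are `U_K ∪ {e ∈ ω}`;
* **`combHereditary_orCoord_five_all`** — THE `|G| = 5` RUNG OF COMB H-MIX(5): for every finite cube and every `CombHereditary` quintuple `U` of increasing events
  ignoring `e`, `(U_j ∪ {e ∈ ω})_{j<5}` is again `CombHereditary` (irredundant rows of order `m ≤ 4` are top rows of the all-OR-ed derived family `(U_{K_j})_j` padded
  with `Ω` — comb H-MIX(4), `combHereditary_orCoord_four`; order `5` = comb TOP(5)); law shadows `hereditaryAllOrders_orCoord_five_all`,
  `sahiE_orCoord_five_all_row_nonneg`.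
With gen 11's single-member step (`combHereditary_orCoord_sel`, every `n`) the comb H-MIX(5) ladder in the number `|G|` of OR-ed members now reads: `|G| ≤ 1` TRUE
(every `n`), `|G| = 5` TRUE (this file), `|G| ∈ {2, 3}` false at the law level (`…SahiMixtureHereditaryCex5`, `…SahiMixtureSingletonFiveThree`), `|G| = 4` open
(all its cells are numerically nonnegative on `𝒦_5`, HIERARCHY §15(a); certificates in progress).
HONEST FRAMING: closure properties of the hereditary comb class; nothing here asserts (M⁺-k) or `C_k` for `k ≥ 3`. [this work]
-/

noncomputable section

open scoped Classical

namespace Summit.CriticalPhenomena.PercolationContinuityZ3.Theorems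

open Finset Function
open Literature.Combinatorics.Sahi2008
open Literature.Probability.Percolation.BHK2006 (ind_le_one ind_inter)
open Literature.Probability.Percolation.DecisionTree (ind ind_of_mem ind_of_not_mem ind_nonneg)
open SahiComb
open SahiCombDisjunct (orCoord)
open SahiCombHereditary (CombHereditary combHereditary_of_irredundant exists_perm_of_irredundant isUpperSet_biInter)
open SahiMixture (orCoin coinWeight Irredundant)

variable {ι : Type} [Fintype ι]

namespace SahiCombMix

/-- `μ_p(f) − μ_p(g)` is comb-positive at multidegree `1` off `e` whenever `g ≤ f` pointwise and both ignore `e`. [this work] -/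
theorem combPos_ex_sub_off (e : ι) (f g : Set ι → ℝ) (hle : ∀ ω, g ω ≤ f ω) (hf : ∀ ω, f (insert e ω) = f ω)
    (hg : ∀ ω, g (insert e ω) = g ω) :
    CombPos (update (fun _ : ι => 1) e 0) (fun p => ex (bernoulliWeight p) f - ex (bernoulliWeight p) g) := by
  have h0 := (combPos_ex (ι := ι) (h := fun ω => f ω - g ω) fun ω => sub_nonneg.2 (hle ω)).of_ignores e
    fun p s => SahiCombDisjunct.ex_update_of_ignores' e (fun ω => by
      show f (insert e ω) - g (insert e ω) = f ω - g ω
      rw [hf, hg]) p s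
  refine h0.congr fun p => ?_
  have ee := SahiMixture.ex_eq_lin (bernoulliWeight p) (fun ω => f ω - g ω) ![1, -1] ![f, g]
    (fun ω => by simp [Fin.sum_univ_succ]; ring)
  simp only [Fin.sum_univ_succ, Fin.sum_univ_zero, Matrix.cons_val_zero, Matrix.cons_val_succ] at ee
  rw [ee]; ring

/-- `1 − μ_p(g)` is comb-positive at multidegree `1` off `e` whenever `g ≤ 1` pointwise and ignores `e`. [this work] -/
theorem combPos_one_sub_ex_off (e : ι) (g : Set ι → ℝ) (hle : ∀ ω, g ω ≤ 1) (hg : ∀ ω, g (insert e ω) = g ω) :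
    CombPos (update (fun _ : ι => 1) e 0) (fun p => 1 - ex (bernoulliWeight p) g) := by
  have h0 := (combPos_ex (ι := ι) (h := fun ω => 1 - g ω) fun ω => sub_nonneg.2 (hle ω)).of_ignores e
    fun p s => SahiCombDisjunct.ex_update_of_ignores' e (fun ω => by
      show 1 - g (insert e ω) = 1 - g ω
      rw [hg]) p s
  refine h0.congr fun p => ?_
  have ee := SahiMixture.ex_eq_lin (bernoulliWeight p) (fun ω => 1 - g ω) ![1, -1] ![fun _ => 1, g]
    (fun ω => by simp [Fin.sum_univ_succ]; ring)
  simp only [Fin.sum_univ_succ, Fin.sum_univ_zero, Matrix.cons_val_zero, Matrix.cons_val_succ, ex_const (sum_bernoulliWeight p)] at ee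
  rw [ee]; ring

section TopFive

variable (U : Fin 5 → Set (Set ι)) (e : ι) (hUe : ∀ (j : Fin 5) (b : Bool), secAt e b (U j) = U j)
include hUe

/-- The codefects `1 − μ_p(U_r)`. [this work] -/
theorem top5_co (r : Fin 5) : CombPos (update (fun _ : ι => 1) e 0) (fun p => 1 - ex (bernoulliWeight p) (ind (U r))) :=
  combPos_one_sub_ex_off e _ (fun ω => ind_le_one (U r) ω) (fun ω => ind_U5_insert U e hUe r ω)

/-- The pair codefects `1 − μ_p(U_a U_b)`. [this work] -/
theorem top5_cod (a b : Fin 5) :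
    CombPos (update (fun _ : ι => 1) e 0) (fun p => 1 - ex (bernoulliWeight p) (ind (U a) * ind (U b))) :=
  combPos_one_sub_ex_off e _ (fun ω => by
      show ind (U a) ω * ind (U b) ω ≤ 1
      exact mul_le_one₀ (ind_le_one _ ω) (ind_nonneg _ ω) (ind_le_one _ ω))
    (fun ω => by show ind (U a) (insert e ω) * ind (U b) (insert e ω) = ind (U a) ω * ind (U b) ω; rw [ind_U5_insert U e hUe, ind_U5_insert U e hUe])

/-- `μ_p(U_a) − μ_p(U_a U_b)`. [this work] -/
theorem top5_sdL (a b : Fin 5) :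
    CombPos (update (fun _ : ι => 1) e 0) (fun p => ex (bernoulliWeight p) (ind (U a)) - ex (bernoulliWeight p) (ind (U a) * ind (U b))) :=
  combPos_ex_sub_off e _ _ (fun ω => by
      show ind (U a) ω * ind (U b) ω ≤ ind (U a) ω
      exact mul_le_of_le_one_right (ind_nonneg _ ω) (ind_le_one _ ω))
    (fun ω => ind_U5_insert U e hUe a ω)
    (fun ω => by show ind (U a) (insert e ω) * ind (U b) (insert e ω) = ind (U a) ω * ind (U b) ω; rw [ind_U5_insert U e hUe, ind_U5_insert U e hUe])

/-- `μ_p(U_b) − μ_p(U_a U_b)`. [this work] -/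
theorem top5_sdR (a b : Fin 5) :
    CombPos (update (fun _ : ι => 1) e 0) (fun p => ex (bernoulliWeight p) (ind (U b)) - ex (bernoulliWeight p) (ind (U a) * ind (U b))) :=
  combPos_ex_sub_off e _ _ (fun ω => by
      show ind (U a) ω * ind (U b) ω ≤ ind (U b) ω
      exact mul_le_of_le_one_left (ind_nonneg _ ω) (ind_le_one _ ω))
    (fun ω => ind_U5_insert U e hUe b ω)
    (fun ω => by show ind (U a) (insert e ω) * ind (U b) (insert e ω) = ind (U a) ω * ind (U b) ω; rw [ind_U5_insert U e hUe, ind_U5_insert U e hUe])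

/-- `μ_p(U-pair) − μ_p(U_x U_y U_z)` (the pair omits `x`). [this work] -/
theorem top5_pdA (x y z : Fin 5) :
    CombPos (update (fun _ : ι => 1) e 0) (fun p => ex (bernoulliWeight p) (ind (U y) * ind (U z)) - ex (bernoulliWeight p) (ind (U x) * ind (U y) * ind (U z))) :=
  combPos_ex_sub_off e _ _ (fun ω => by
      show ind (U x) ω * ind (U y) ω * ind (U z) ω ≤ ind (U y) ω * ind (U z) ω
      by_cases hx : ω ∈ U x <;> by_cases hy : ω ∈ U y <;> by_cases hz : ω ∈ U z <;>
        norm_num [ind_of_mem, ind_of_not_mem, hx, hy, hz])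
    (fun ω => by show ind (U y) (insert e ω) * ind (U z) (insert e ω) = ind (U y) ω * ind (U z) ω; simp only [ind_U5_insert U e hUe])
    (fun ω => by show ind (U x) (insert e ω) * ind (U y) (insert e ω) * ind (U z) (insert e ω) = ind (U x) ω * ind (U y) ω * ind (U z) ω; simp only [ind_U5_insert U e hUe])

/-- `μ_p(U-pair) − μ_p(U_x U_y U_z)` (the pair omits `y`). [this work] -/
theorem top5_pdB (x y z : Fin 5) :
    CombPos (update (fun _ : ι => 1) e 0) (fun p => ex (bernoulliWeight p) (ind (U x) * ind (U z)) - ex (bernoulliWeight p) (ind (U x) * ind (U y) * ind (U z))) :=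
  combPos_ex_sub_off e _ _ (fun ω => by
      show ind (U x) ω * ind (U y) ω * ind (U z) ω ≤ ind (U x) ω * ind (U z) ω
      by_cases hx : ω ∈ U x <;> by_cases hy : ω ∈ U y <;> by_cases hz : ω ∈ U z <;>
        norm_num [ind_of_mem, ind_of_not_mem, hx, hy, hz])
    (fun ω => by show ind (U x) (insert e ω) * ind (U z) (insert e ω) = ind (U x) ω * ind (U z) ω; simp only [ind_U5_insert U e hUe])
    (fun ω => by show ind (U x) (insert e ω) * ind (U y) (insert e ω) * ind (U z) (insert e ω) = ind (U x) ω * ind (U y) ω * ind (U z) ω; simp only [ind_U5_insert U e hUe])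

/-- `μ_p(U-pair) − μ_p(U_x U_y U_z)` (the pair omits `z`). [this work] -/
theorem top5_pdC (x y z : Fin 5) :
    CombPos (update (fun _ : ι => 1) e 0) (fun p => ex (bernoulliWeight p) (ind (U x) * ind (U y)) - ex (bernoulliWeight p) (ind (U x) * ind (U y) * ind (U z))) :=
  combPos_ex_sub_off e _ _ (fun ω => by
      show ind (U x) ω * ind (U y) ω * ind (U z) ω ≤ ind (U x) ω * ind (U y) ω
      by_cases hx : ω ∈ U x <;> by_cases hy : ω ∈ U y <;> by_cases hz : ω ∈ U z <;>
        norm_num [ind_of_mem, ind_of_not_mem, hx, hy, hz])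
    (fun ω => by show ind (U x) (insert e ω) * ind (U y) (insert e ω) = ind (U x) ω * ind (U y) ω; simp only [ind_U5_insert U e hUe])
    (fun ω => by show ind (U x) (insert e ω) * ind (U y) (insert e ω) * ind (U z) (insert e ω) = ind (U x) ω * ind (U y) ω * ind (U z) ω; simp only [ind_U5_insert U e hUe])

/-- `T₁/6 = 1 − Σ_{|S|=4} μ_p(U_S) + 4μ_p(U_{01234}) = μ_p(|{j : ω ∈ U_j}| ≤ 3) ≥ 0`, comb-positive at multidegree `1` off `e`. [this work] -/
theorem combPos_atMostThree_five :
    CombPos (update (fun _ : ι => 1) e 0) (fun p => 1 - (ex (bernoulliWeight p) (ind (U 0) * ind (U 1) * ind (U 2) * ind (U 3)) + ex (bernoulliWeight p) (ind (U 0) * ind (U 1) * ind (U 2) * ind (U 4)) + ex (bernoulliWeight p) (ind (U 0) * ind (U 1) * ind (U 3) * ind (U 4)) + ex (bernoulliWeight p) (ind (U 0) * ind (U 2) * ind (U 3) * ind (U 4)) + ex (bernoulliWeight p) (ind (U 1) * ind (U 2) * ind (U 3) * ind (U 4))) + 4 * ex (bernoulliWeight p) (ind (U 0) * ind (U 1)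 * ind (U 2) * ind (U 3) * ind (U 4))) := by
  have hg : ∀ ω, 0 ≤ 1 - (ind (U 0) ω * ind (U 1) ω * ind (U 2) ω * ind (U 3) ω + ind (U 0) ω * ind (U 1) ω * ind (U 2) ω * ind (U 4) ω + ind (U 0) ω * ind (U 1) ω * ind (U 3) ω * ind (U 4) ω + ind (U 0) ω * ind (U 2) ω * ind (U 3) ω * ind (U 4) ω + ind (U 1) ω * ind (U 2) ω * ind (U 3) ω * ind (U 4) ω) + 4 * (ind (U 0) ω * ind (U 1) ω * ind (U 2) ω * ind (U 3) ω * ind (U 4) ω) := by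
    intro ω
    by_cases h0 : ω ∈ U 0 <;> by_cases h1 : ω ∈ U 1 <;> by_cases h2 : ω ∈ U 2 <;> by_cases h3 : ω ∈ U 3 <;> by_cases h4 : ω ∈ U 4 <;>
      norm_num [ind_of_mem, ind_of_not_mem, h0, h1, h2, h3, h4]
  have h0 := (combPos_ex (ι := ι) (h := fun ω => 1 - (ind (U 0) ω * ind (U 1) ω * ind (U 2) ω * ind (U 3) ω + ind (U 0) ω * ind (U 1) ω * ind (U 2) ω * ind (U 4) ω + ind (U 0) ω * ind (U 1) ω * ind (U 3) ω * ind (U 4) ω + ind (U 0) ω * ind (U 2) ω * ind (U 3) ω * ind (U 4) ω + ind (U 1) ω * ind (U 2) ω * ind (U 3) ω * ind (U 4) ω) + 4 * (ind (U 0) ω * ind (U 1) ω * ind (U 2) ω * ind (U 3) ω * ind (U 4) ω)) hg).of_ignores e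
    fun p s => SahiCombDisjunct.ex_update_of_ignores' e (fun ω => by
      show 1 - (ind (U 0) (insert e ω) * ind (U 1) (insert e ω) * ind (U 2) (insert e ω) * ind (U 3) (insert e ω) + ind (U 0) (insert e ω) * ind (U 1) (insert e ω) * ind (U 2) (insert e ω) * ind (U 4) (insert e ω) + ind (U 0) (insert e ω) * ind (U 1) (insert e ω) * ind (U 3) (insert e ω) * ind (U 4) (insert e ω) + ind (U 0) (insert e ω) * ind (U 2) (insert e ω) * ind (U 3) (insert e ω) * ind (U 4) (insert e ω) + ind (U 1) (insert e ω) * ind (U 2) (insert e ω) * ind (U 3) (insert e ω) * ind (U 4) (insert e ω)) + 4 * (ind (U 0) (insert e ω) * ind (U 1) (insert e ω) * ind (U 2) (insert e ω) * ind (U 3) (insert e ω) * ind (U 4) (insert e ω)) = 1 - (ind (U 0) ω * ind (U 1) ω * ind (U 2) ω * ind (U 3) ω + ind (U 0) ω * ind (U 1) ω * ind (U 2) ω * ind (U 4) ω + ind (U 0) ω * ind (U 1) ω * ind (U 3) ω * ind (U 4) ω + ind (U 0) ω * ind (U 2) ω * ind (U 3) ω * ind (U 4) ω + ind (U 1) ω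 * ind (U 2) ω * ind (U 3) ω * ind (U 4) ω) + 4 * (ind (U 0) ω * ind (U 1) ω * ind (U 2) ω * ind (U 3) ω * ind (U 4) ω)
      simp only [ind_U5_insert U e hUe]) p s
  refine h0.congr fun p => ?_
  have ee := SahiMixture.ex_eq_lin (bernoulliWeight p) (fun ω => 1 - (ind (U 0) ω * ind (U 1) ω * ind (U 2) ω * ind (U 3) ω + ind (U 0) ω * ind (U 1) ω * ind (U 2) ω * ind (U 4) ω + ind (U 0) ω * ind (U 1) ω * ind (U 3) ω * ind (U 4) ω + ind (U 0) ω * ind (U 2) ω * ind (U 3) ω * ind (U 4) ω + ind (U 1) ω * ind (U 2) ω * ind (U 3) ω * ind (U 4) ω) + 4 * (ind (U 0) ω * ind (U 1) ω * ind (U 2) ω * ind (U 3) ω * ind (U 4) ω))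
    ![1, -1, -1, -1, -1, -1, 4] ![fun _ => 1, ind (U 0) * ind (U 1) * ind (U 2) * ind (U 3), ind (U 0) * ind (U 1) * ind (U 2) * ind (U 4), ind (U 0) * ind (U 1) * ind (U 3) * ind (U 4), ind (U 0) * ind (U 2) * ind (U 3) * ind (U 4), ind (U 1) * ind (U 2) * ind (U 3) * ind (U 4), ind (U 0) * ind (U 1) * ind (U 2) * ind (U 3) * ind (U 4)]
    (fun ω => by simp [Fin.sum_univ_succ]; ring)
  simp only [Fin.sum_univ_succ, Fin.sum_univ_zero, Matrix.cons_val_zero, Matrix.cons_val_succ, ex_const (sum_bernoulliWeight p)] at ee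
  rw [ee]; ring

/-- **COMB TOP(5).**  For five events ignoring `e` with `CombHereditary U` (only the row `E_5(U)` off `e` is used), the top row of the family with the coordinate `e`
OR-ed into ALL five members is comb-positive at multidegree `5`. [this work] -/
theorem combPos_five_orCoord_all (hU : CombHereditary U) :
    CombPos (fun _ : ι => 5) (fun p => sahiE (bernoulliWeight p) 5 (fun j => ind (orCoord U e (fun _ => true) j))) := by
  -- the hereditary comb row E_5(U) off e
  have eU : (fun j => ind (⋂ i ∈ (![({0} : Finset (Fin 5)), {1}, {2}, {3}, {4}] : Fin 5 → Finset (Fin 5)) j, U i))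
      = ![ind (U 0), ind (U 1), ind (U 2), ind (U 3), ind (U 4)] := by
    funext j; fin_cases j <;> simp
  have r5 := hU.row_off e hUe 5 ![({0} : Finset (Fin 5)), {1}, {2}, {3}, {4}]
  rw [eU] at r5
  -- codefects
  have c0 := top5_co U e hUe 0
  have c1 := top5_co U e hUe 1
  have c2 := top5_co U e hUe 2
  have c3 := top5_co U e hUe 3
  have c4 := top5_co U e hUe 4
  have T1 := (combPos_atMostThree_five U e hUe).smul (by norm_num : (0:ℝ) ≤ 6)
  -- N₅ = Π (1 − μ(U_i))  (multidegree 5 off e)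
  have N5 := (combPos_mono4 e c0 c1 c2 c3).mul_of_le c4 (deg_off_add_le e (show 4 + 1 ≤ 5 by norm_num))
  have q0 := combPos_mono4 e c1 c2 c3 c4
  have q1 := combPos_mono4 e c0 c2 c3 c4
  have q2 := combPos_mono4 e c0 c1 c3 c4
  have q3 := combPos_mono4 e c0 c1 c2 c4
  have q4 := combPos_mono4 e c0 c1 c2 c3
  have s0_1 := combPos_mono4 e (top5_sdL U e hUe 0 1) c2 c3 c4
  have s0_2 := combPos_mono4 e (top5_sdL U e hUe 0 2) c1 c3 c4
  have s0_3 := combPos_mono4 e (top5_sdL U e hUe 0 3) c1 c2 c4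
  have s0_4 := combPos_mono4 e (top5_sdL U e hUe 0 4) c1 c2 c3
  have s1_0 := combPos_mono4 e (top5_sdR U e hUe 0 1) c2 c3 c4
  have s1_2 := combPos_mono4 e (top5_sdL U e hUe 1 2) c0 c3 c4
  have s1_3 := combPos_mono4 e (top5_sdL U e hUe 1 3) c0 c2 c4
  have s1_4 := combPos_mono4 e (top5_sdL U e hUe 1 4) c0 c2 c3
  have s2_0 := combPos_mono4 e (top5_sdR U e hUe 0 2) c1 c3 c4
  have s2_1 := combPos_mono4 e (top5_sdR U e hUe 1 2) c0 c3 c4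
  have s2_3 := combPos_mono4 e (top5_sdL U e hUe 2 3) c0 c1 c4
  have s2_4 := combPos_mono4 e (top5_sdL U e hUe 2 4) c0 c1 c3
  have s3_0 := combPos_mono4 e (top5_sdR U e hUe 0 3) c1 c2 c4
  have s3_1 := combPos_mono4 e (top5_sdR U e hUe 1 3) c0 c2 c4
  have s3_2 := combPos_mono4 e (top5_sdR U e hUe 2 3) c0 c1 c4
  have s3_4 := combPos_mono4 e (top5_sdL U e hUe 3 4) c0 c1 c2
  have s4_0 := combPos_mono4 e (top5_sdR U e hUe 0 4) c1 c2 c3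
  have s4_1 := combPos_mono4 e (top5_sdR U e hUe 1 4) c0 c2 c3
  have s4_2 := combPos_mono4 e (top5_sdR U e hUe 2 4) c0 c1 c3
  have s4_3 := combPos_mono4 e (top5_sdR U e hUe 3 4) c0 c1 c2
  have N4 := (((((q0.add q1).add q2).add q3).add q4)).add (((((((((((((((((((((s0_1.add s0_2).add s0_3).add s0_4).add s1_0).add s1_2).add s1_3).add s1_4).add s2_0).add s2_1).add s2_3).add s2_4).add s3_0).add s3_1).add s3_2).add s3_4).add s4_0).add s4_1).add s4_2).add s4_3)).smul (by norm_num : (0:ℝ) ≤ 1 / 2))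
  have a012 := combPos_mono3 e (((top5_pdA U e hUe 0 1 2).add (top5_pdB U e hUe 0 1 2)).add (top5_pdC U e hUe 0 1 2)) c3 c4
  have a013 := combPos_mono3 e (((top5_pdA U e hUe 0 1 3).add (top5_pdB U e hUe 0 1 3)).add (top5_pdC U e hUe 0 1 3)) c2 c4
  have a014 := combPos_mono3 e (((top5_pdA U e hUe 0 1 4).add (top5_pdB U e hUe 0 1 4)).add (top5_pdC U e hUe 0 1 4)) c2 c3
  have a023 := combPos_mono3 e (((top5_pdA U e hUe 0 2 3).add (top5_pdB U e hUe 0 2 3)).add (top5_pdC U e hUe 0 2 3)) c1 c4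
  have a024 := combPos_mono3 e (((top5_pdA U e hUe 0 2 4).add (top5_pdB U e hUe 0 2 4)).add (top5_pdC U e hUe 0 2 4)) c1 c3
  have a034 := combPos_mono3 e (((top5_pdA U e hUe 0 3 4).add (top5_pdB U e hUe 0 3 4)).add (top5_pdC U e hUe 0 3 4)) c1 c2
  have a123 := combPos_mono3 e (((top5_pdA U e hUe 1 2 3).add (top5_pdB U e hUe 1 2 3)).add (top5_pdC U e hUe 1 2 3)) c0 c4
  have a124 := combPos_mono3 e (((top5_pdA U e hUe 1 2 4).add (top5_pdB U e hUe 1 2 4)).add (top5_pdC U e hUe 1 2 4)) c0 c3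
  have a134 := combPos_mono3 e (((top5_pdA U e hUe 1 3 4).add (top5_pdB U e hUe 1 3 4)).add (top5_pdC U e hUe 1 3 4)) c0 c2
  have a234 := combPos_mono3 e (((top5_pdA U e hUe 2 3 4).add (top5_pdB U e hUe 2 3 4)).add (top5_pdC U e hUe 2 3 4)) c0 c1
  have b1234 := combPos_mono12 e (top5_co U e hUe 0) ((((((combPos_mono2 e (top5_cod U e hUe 1 2) (top5_cod U e hUe 3 4)).smul (by norm_num : (0:ℝ) ≤ 1 / 3)).add ((combPos_mono2 e (top5_cod U e hUe 1 2) (top5_sdR U e hUe 3 4)).smul (by norm_num : (0:ℝ) ≤ 1 / 6))).add ((combPos_mono2 e (top5_cod U e hUe 1 2) (top5_sdL U e hUe 3 4)).smul (by norm_num : (0:ℝ) ≤ 1 / 6))).add ((combPos_mono2 e (top5_cod U e hUe 3 4) (top5_sdR U e hUe 1 2)).smul (by norm_num : (0:ℝ) ≤ 1 / 6))).add ((combPos_mono2 e (top5_cod U e hUe 3 4) (top5_sdL U e hUe 1 2)).smul (by norm_num : (0:ℝ) ≤ 1 / 6)))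
  have b1324 := combPos_mono12 e (top5_co U e hUe 0) ((((((combPos_mono2 e (top5_cod U e hUe 1 3) (top5_cod U e hUe 2 4)).smul (by norm_num : (0:ℝ) ≤ 1 / 3)).add ((combPos_mono2 e (top5_cod U e hUe 1 3) (top5_sdR U e hUe 2 4)).smul (by norm_num : (0:ℝ) ≤ 1 / 6))).add ((combPos_mono2 e (top5_cod U e hUe 1 3) (top5_sdL U e hUe 2 4)).smul (by norm_num : (0:ℝ) ≤ 1 / 6))).add ((combPos_mono2 e (top5_cod U e hUe 2 4) (top5_sdR U e hUe 1 3)).smul (by norm_num : (0:ℝ) ≤ 1 / 6))).add ((combPos_mono2 e (top5_cod U e hUe 2 4) (top5_sdL U e hUe 1 3)).smul (by norm_num : (0:ℝ) ≤ 1 / 6)))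
  have b1423 := combPos_mono12 e (top5_co U e hUe 0) ((((((combPos_mono2 e (top5_cod U e hUe 1 4) (top5_cod U e hUe 2 3)).smul (by norm_num : (0:ℝ) ≤ 1 / 3)).add ((combPos_mono2 e (top5_cod U e hUe 1 4) (top5_sdR U e hUe 2 3)).smul (by norm_num : (0:ℝ) ≤ 1 / 6))).add ((combPos_mono2 e (top5_cod U e hUe 1 4) (top5_sdL U e hUe 2 3)).smul (by norm_num : (0:ℝ) ≤ 1 / 6))).add ((combPos_mono2 e (top5_cod U e hUe 2 3) (top5_sdR U e hUe 1 4)).smul (by norm_num : (0:ℝ) ≤ 1 / 6))).add ((combPos_mono2 e (top5_cod U e hUe 2 3) (top5_sdL U e hUe 1 4)).smul (by norm_num : (0:ℝ) ≤ 1 / 6)))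
  have b0234 := combPos_mono12 e (top5_co U e hUe 1) ((((((combPos_mono2 e (top5_cod U e hUe 0 2) (top5_cod U e hUe 3 4)).smul (by norm_num : (0:ℝ) ≤ 1 / 3)).add ((combPos_mono2 e (top5_cod U e hUe 0 2) (top5_sdR U e hUe 3 4)).smul (by norm_num : (0:ℝ) ≤ 1 / 6))).add ((combPos_mono2 e (top5_cod U e hUe 0 2) (top5_sdL U e hUe 3 4)).smul (by norm_num : (0:ℝ) ≤ 1 / 6))).add ((combPos_mono2 e (top5_cod U e hUe 3 4) (top5_sdR U e hUe 0 2)).smul (by norm_num : (0:ℝ) ≤ 1 / 6))).add ((combPos_mono2 e (top5_cod U e hUe 3 4) (top5_sdL U e hUe 0 2)).smul (by norm_num : (0:ℝ) ≤ 1 / 6)))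
  have b0324 := combPos_mono12 e (top5_co U e hUe 1) ((((((combPos_mono2 e (top5_cod U e hUe 0 3) (top5_cod U e hUe 2 4)).smul (by norm_num : (0:ℝ) ≤ 1 / 3)).add ((combPos_mono2 e (top5_cod U e hUe 0 3) (top5_sdR U e hUe 2 4)).smul (by norm_num : (0:ℝ) ≤ 1 / 6))).add ((combPos_mono2 e (top5_cod U e hUe 0 3) (top5_sdL U e hUe 2 4)).smul (by norm_num : (0:ℝ) ≤ 1 / 6))).add ((combPos_mono2 e (top5_cod U e hUe 2 4) (top5_sdR U e hUe 0 3)).smul (by norm_num : (0:ℝ) ≤ 1 / 6))).add ((combPos_mono2 e (top5_cod U e hUe 2 4) (top5_sdL U e hUe 0 3)).smul (by norm_num : (0:ℝ) ≤ 1 / 6)))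
  have b0423 := combPos_mono12 e (top5_co U e hUe 1) ((((((combPos_mono2 e (top5_cod U e hUe 0 4) (top5_cod U e hUe 2 3)).smul (by norm_num : (0:ℝ) ≤ 1 / 3)).add ((combPos_mono2 e (top5_cod U e hUe 0 4) (top5_sdR U e hUe 2 3)).smul (by norm_num : (0:ℝ) ≤ 1 / 6))).add ((combPos_mono2 e (top5_cod U e hUe 0 4) (top5_sdL U e hUe 2 3)).smul (by norm_num : (0:ℝ) ≤ 1 / 6))).add ((combPos_mono2 e (top5_cod U e hUe 2 3) (top5_sdR U e hUe 0 4)).smul (by norm_num : (0:ℝ) ≤ 1 / 6))).add ((combPos_mono2 e (top5_cod U e hUe 2 3) (top5_sdL U e hUe 0 4)).smul (by norm_num : (0:ℝ) ≤ 1 / 6)))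
  have b0134 := combPos_mono12 e (top5_co U e hUe 2) ((((((combPos_mono2 e (top5_cod U e hUe 0 1) (top5_cod U e hUe 3 4)).smul (by norm_num : (0:ℝ) ≤ 1 / 3)).add ((combPos_mono2 e (top5_cod U e hUe 0 1) (top5_sdR U e hUe 3 4)).smul (by norm_num : (0:ℝ) ≤ 1 / 6))).add ((combPos_mono2 e (top5_cod U e hUe 0 1) (top5_sdL U e hUe 3 4)).smul (by norm_num : (0:ℝ) ≤ 1 / 6))).add ((combPos_mono2 e (top5_cod U e hUe 3 4) (top5_sdR U e hUe 0 1)).smul (by norm_num : (0:ℝ) ≤ 1 / 6))).add ((combPos_mono2 e (top5_cod U e hUe 3 4) (top5_sdL U e hUe 0 1)).smul (by norm_num : (0:ℝ) ≤ 1 / 6)))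
  have b0314 := combPos_mono12 e (top5_co U e hUe 2) ((((((combPos_mono2 e (top5_cod U e hUe 0 3) (top5_cod U e hUe 1 4)).smul (by norm_num : (0:ℝ) ≤ 1 / 3)).add ((combPos_mono2 e (top5_cod U e hUe 0 3) (top5_sdR U e hUe 1 4)).smul (by norm_num : (0:ℝ) ≤ 1 / 6))).add ((combPos_mono2 e (top5_cod U e hUe 0 3) (top5_sdL U e hUe 1 4)).smul (by norm_num : (0:ℝ) ≤ 1 / 6))).add ((combPos_mono2 e (top5_cod U e hUe 1 4) (top5_sdR U e hUe 0 3)).smul (by norm_num : (0:ℝ) ≤ 1 / 6))).add ((combPos_mono2 e (top5_cod U e hUe 1 4) (top5_sdL U e hUe 0 3)).smul (by norm_num : (0:ℝ) ≤ 1 / 6)))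
  have b0413 := combPos_mono12 e (top5_co U e hUe 2) ((((((combPos_mono2 e (top5_cod U e hUe 0 4) (top5_cod U e hUe 1 3)).smul (by norm_num : (0:ℝ) ≤ 1 / 3)).add ((combPos_mono2 e (top5_cod U e hUe 0 4) (top5_sdR U e hUe 1 3)).smul (by norm_num : (0:ℝ) ≤ 1 / 6))).add ((combPos_mono2 e (top5_cod U e hUe 0 4) (top5_sdL U e hUe 1 3)).smul (by norm_num : (0:ℝ) ≤ 1 / 6))).add ((combPos_mono2 e (top5_cod U e hUe 1 3) (top5_sdR U e hUe 0 4)).smul (by norm_num : (0:ℝ) ≤ 1 / 6))).add ((combPos_mono2 e (top5_cod U e hUe 1 3) (top5_sdL U e hUe 0 4)).smul (by norm_num : (0:ℝ) ≤ 1 / 6)))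
  have b0124 := combPos_mono12 e (top5_co U e hUe 3) ((((((combPos_mono2 e (top5_cod U e hUe 0 1) (top5_cod U e hUe 2 4)).smul (by norm_num : (0:ℝ) ≤ 1 / 3)).add ((combPos_mono2 e (top5_cod U e hUe 0 1) (top5_sdR U e hUe 2 4)).smul (by norm_num : (0:ℝ) ≤ 1 / 6))).add ((combPos_mono2 e (top5_cod U e hUe 0 1) (top5_sdL U e hUe 2 4)).smul (by norm_num : (0:ℝ) ≤ 1 / 6))).add ((combPos_mono2 e (top5_cod U e hUe 2 4) (top5_sdR U e hUe 0 1)).smul (by norm_num : (0:ℝ) ≤ 1 / 6))).add ((combPos_mono2 e (top5_cod U e hUe 2 4) (top5_sdL U e hUe 0 1)).smul (by norm_num : (0:ℝ) ≤ 1 / 6)))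
  have b0214 := combPos_mono12 e (top5_co U e hUe 3) ((((((combPos_mono2 e (top5_cod U e hUe 0 2) (top5_cod U e hUe 1 4)).smul (by norm_num : (0:ℝ) ≤ 1 / 3)).add ((combPos_mono2 e (top5_cod U e hUe 0 2) (top5_sdR U e hUe 1 4)).smul (by norm_num : (0:ℝ) ≤ 1 / 6))).add ((combPos_mono2 e (top5_cod U e hUe 0 2) (top5_sdL U e hUe 1 4)).smul (by norm_num : (0:ℝ) ≤ 1 / 6))).add ((combPos_mono2 e (top5_cod U e hUe 1 4) (top5_sdR U e hUe 0 2)).smul (by norm_num : (0:ℝ) ≤ 1 / 6))).add ((combPos_mono2 e (top5_cod U e hUe 1 4) (top5_sdL U e hUe 0 2)).smul (by norm_num : (0:ℝ) ≤ 1 / 6)))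
  have b0412 := combPos_mono12 e (top5_co U e hUe 3) ((((((combPos_mono2 e (top5_cod U e hUe 0 4) (top5_cod U e hUe 1 2)).smul (by norm_num : (0:ℝ) ≤ 1 / 3)).add ((combPos_mono2 e (top5_cod U e hUe 0 4) (top5_sdR U e hUe 1 2)).smul (by norm_num : (0:ℝ) ≤ 1 / 6))).add ((combPos_mono2 e (top5_cod U e hUe 0 4) (top5_sdL U e hUe 1 2)).smul (by norm_num : (0:ℝ) ≤ 1 / 6))).add ((combPos_mono2 e (top5_cod U e hUe 1 2) (top5_sdR U e hUe 0 4)).smul (by norm_num : (0:ℝ) ≤ 1 / 6))).add ((combPos_mono2 e (top5_cod U e hUe 1 2) (top5_sdL U e hUe 0 4)).smul (by norm_num : (0:ℝ) ≤ 1 / 6)))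
  have b0123 := combPos_mono12 e (top5_co U e hUe 4) ((((((combPos_mono2 e (top5_cod U e hUe 0 1) (top5_cod U e hUe 2 3)).smul (by norm_num : (0:ℝ) ≤ 1 / 3)).add ((combPos_mono2 e (top5_cod U e hUe 0 1) (top5_sdR U e hUe 2 3)).smul (by norm_num : (0:ℝ) ≤ 1 / 6))).add ((combPos_mono2 e (top5_cod U e hUe 0 1) (top5_sdL U e hUe 2 3)).smul (by norm_num : (0:ℝ) ≤ 1 / 6))).add ((combPos_mono2 e (top5_cod U e hUe 2 3) (top5_sdR U e hUe 0 1)).smul (by norm_num : (0:ℝ) ≤ 1 / 6))).add ((combPos_mono2 e (top5_cod U e hUe 2 3) (top5_sdL U e hUe 0 1)).smul (by norm_num : (0:ℝ) ≤ 1 / 6)))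
  have b0213 := combPos_mono12 e (top5_co U e hUe 4) ((((((combPos_mono2 e (top5_cod U e hUe 0 2) (top5_cod U e hUe 1 3)).smul (by norm_num : (0:ℝ) ≤ 1 / 3)).add ((combPos_mono2 e (top5_cod U e hUe 0 2) (top5_sdR U e hUe 1 3)).smul (by norm_num : (0:ℝ) ≤ 1 / 6))).add ((combPos_mono2 e (top5_cod U e hUe 0 2) (top5_sdL U e hUe 1 3)).smul (by norm_num : (0:ℝ) ≤ 1 / 6))).add ((combPos_mono2 e (top5_cod U e hUe 1 3) (top5_sdR U e hUe 0 2)).smul (by norm_num : (0:ℝ) ≤ 1 / 6))).add ((combPos_mono2 e (top5_cod U e hUe 1 3) (top5_sdL U e hUe 0 2)).smul (by norm_num : (0:ℝ) ≤ 1 / 6)))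
  have b0312 := combPos_mono12 e (top5_co U e hUe 4) ((((((combPos_mono2 e (top5_cod U e hUe 0 3) (top5_cod U e hUe 1 2)).smul (by norm_num : (0:ℝ) ≤ 1 / 3)).add ((combPos_mono2 e (top5_cod U e hUe 0 3) (top5_sdR U e hUe 1 2)).smul (by norm_num : (0:ℝ) ≤ 1 / 6))).add ((combPos_mono2 e (top5_cod U e hUe 0 3) (top5_sdL U e hUe 1 2)).smul (by norm_num : (0:ℝ) ≤ 1 / 6))).add ((combPos_mono2 e (top5_cod U e hUe 1 2) (top5_sdR U e hUe 0 3)).smul (by norm_num : (0:ℝ) ≤ 1 / 6))).add ((combPos_mono2 e (top5_cod U e hUe 1 2) (top5_sdL U e hUe 0 3)).smul (by norm_num : (0:ℝ) ≤ 1 / 6)))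
  have N3 := (((((((((((a012.add a013).add a014).add a023).add a024).add a034).add a123).add a124).add a134).add a234)).smul (by norm_num : (0:ℝ) ≤ 2 / 3)).add (((((((((((((((b1234.add b1324).add b1423).add b0234).add b0324).add b0423).add b0134).add b0314).add b0413).add b0124).add b0214).add b0412).add b0123).add b0213).add b0312))
  -- assemble along p_e (h = p_e): every piece has multidegree ≤ 5 off e, the p_e-factors have degree ≤ 5 in e
  have dd : ∀ k : ℕ, k ≤ 5 → (Pi.single e k + update (fun _ : ι => 5) e 0) ≤ fun _ : ι => 5 := fun k hk x => by
    by_cases hx : x = e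
    · subst hx; simp [hk]
    · simp [hx]
  have dd' : ∀ k j : ℕ, k ≤ 5 → j ≤ 5 → (Pi.single e k + update (fun _ : ι => j) e 0) ≤ fun _ : ι => 5 := fun k j hk hj x => by
    by_cases hx : x = e
    · subst hx; simp [hk]
    · simp [hx, hj]
  have sT := (SahiCombDisjunct.combPos_coord_pow e 1 1).mul_of_le T1 (dd' 2 1 (by norm_num) (by norm_num))
  have sE := (SahiCombDisjunct.combPos_coord_pow e 0 2).mul_of_le r5 (dd 2 (by norm_num))
  have s3 := (SahiCombDisjunct.combPos_coord_pow e 1 2).mul_of_le N3 (dd' 3 3 (by norm_num) (by norm_num))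
  have s4a := (SahiCombDisjunct.combPos_coord_pow e 1 2).mul_of_le N4 (dd' 3 4 (by norm_num) (by norm_num))
  have s4b := (SahiCombDisjunct.combPos_coord_pow e 1 3).mul_of_le N4 (dd' 4 4 (by norm_num) (by norm_num))
  have s5a := (SahiCombDisjunct.combPos_coord_pow e 1 2).mul_of_le N5 (dd 3 (by norm_num))
  have s5b := (SahiCombDisjunct.combPos_coord_pow e 1 3).mul_of_le N5 (dd 4 (by norm_num))
  have s5c := (SahiCombDisjunct.combPos_coord_pow e 1 4).mul_of_le N5 (dd 5 (by norm_num))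
  have efam : (fun j => ind (orCoin (U j) ((fun _ : Fin 5 => true) j)))
      = ![ind (orCoin (U 0) true), ind (orCoin (U 1) true), ind (orCoin (U 2) true), ind (orCoin (U 3) true), ind (orCoin (U 4) true)] := by
    funext j; fin_cases j <;> rfl
  refine ((((((sT.add sE).add s3).add s4a).add s4b).add s5a).add (s5b.add s5c)).congr fun p => ?_
  rw [sahiE_orCoord_eq_coin U e _ hUe p, efam,
    SahiMixture.sahiE_five_orCoin_top_eq (sum_bernoulliWeight p) (U 0) (U 1) (U 2) (U 3) (U 4) (p e : ℝ)]
  ring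

/-- Law-level shadow: `E_5(μ_p; U_0∪{e∈ω}, …, U_4∪{e∈ω}) ≥ 0` under every product measure. [this work] -/
theorem sahiE_five_orCoord_all_nonneg (hU : CombHereditary U) (p : ι → unitInterval) :
    0 ≤ sahiE (bernoulliWeight p) 5 (fun j => ind (orCoord U e (fun _ => true) j)) :=
  (combPos_five_orCoord_all U e hUe hU).nonneg p

end TopFive

/-! ### The `|G| = 5` rung of comb H-MIX(5): OR-ing the coordinate into ALL five members -/

section AllFive

omit [Fintype ι] in
/-- The all-true selector: every member receives `∪ {e ∈ ω}`. [this work] -/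
theorem orCoord_all_apply {n : ℕ} (U : Fin n → Set (Set ι)) (e : ι) (j : Fin n) :
    orCoord U e (fun _ => true) j = U j ∪ {ω : Set ι | e ∈ ω} := rfl

omit [Fintype ι] in
/-- Members of the ∩-closed family of the all-OR-ed family: `⋂_{l∈L}(U_l ∪ {e∈ω}) = (⋂_{l∈L} U_l) ∪ {e∈ω}` (also for `L = ∅`). [this work] -/
theorem biInter_orCoord_all {n : ℕ} (U : Fin n → Set (Set ι)) (e : ι) (L : Finset (Fin n)) :
    (⋂ l ∈ L, orCoord U e (fun _ => true) l) = (⋂ l ∈ L, U l) ∪ {ω : Set ι | e ∈ ω} := by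
  ext ω
  simp only [Set.mem_iInter, orCoord_all_apply, Set.mem_union, Set.mem_setOf_eq]
  constructor
  · intro h
    by_cases he : e ∈ ω
    · exact Or.inr he
    · exact Or.inl fun l hl => (h l hl).resolve_right he
  · rintro (h | h) l hl
    · exact Or.inl (h l hl)
    · exact Or.inr h

/-- **COMB H-MIX(5), THE `|G| = 5` RUNG.**  For every finite cube, every quintuple `U` of increasing events ignoring `e` with `CombHereditary U`, the family
`(U_j ∪ {e ∈ ω})_{j<5}` is again `CombHereditary`: an irredundant row with slot map `K` is the top row of the all-OR-ed DERIVED family `(U_{K_j})_j`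
(`biInter_orCoord_all`), which has `m ≤ 4` members (comb H-MIX(4), `combHereditary_orCoord_four`, after padding with `Ω`) or `m = 5` singleton slots
(comb TOP(5), `combPos_five_orCoord_all`). [this work] -/
theorem combHereditary_orCoord_five_all (U : Fin 5 → Set (Set ι)) (e : ι)
    (hUup : ∀ j, IsUpperSet (U j)) (hUe : ∀ (j : Fin 5) (b : Bool), secAt e b (U j) = U j) (hU : CombHereditary U) :
    CombHereditary (orCoord U e (fun _ => true)) := by
  refine combHereditary_of_irredundant _ fun m K hK => ?_
  have hm : m ≤ 5 := hK.card_le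
  have hsec : ∀ (L : Finset (Fin 5)) (b : Bool), secAt e b (⋂ l ∈ L, U l) = ⋂ l ∈ L, U l := fun L b => secAt_biInter U e hUe L b
  -- the row is the top row of the all-OR-ed derived family `W_j = U_{K_j}`
  have eK : (fun j => ind (⋂ l ∈ K j, orCoord U e (fun _ => true) l))
      = fun j => ind (orCoord (fun j => ⋂ l ∈ K j, U l) e (fun _ => true) j) := by
    funext j; rw [biInter_orCoord_all, orCoord_all_apply]
  rw [show (fun p => sahiE (bernoulliWeight p) m (fun j => ind (⋂ l ∈ K j, orCoord U e (fun _ => true) l)))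
      = fun p => sahiE (bernoulliWeight p) m (fun j => ind (orCoord (fun j => ⋂ l ∈ K j, U l) e (fun _ => true) j)) from by rw [eK]]
  have hWher : CombHereditary (fun j => ⋂ l ∈ K j, U l) := hU.of_eq_biInter K (fun j => rfl)
  have hWup : ∀ j, IsUpperSet ((fun j => ⋂ l ∈ K j, U l) j) := fun j => isUpperSet_biInter hUup _
  have hWe : ∀ (j : Fin m) (b : Bool), secAt e b ((fun j => ⋂ l ∈ K j, U l) j) = (fun j => ⋂ l ∈ K j, U l) j := fun j b => hsec _ b
  rcases Nat.lt_or_ge m 5 with hm4 | hm5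
  · -- m ≤ 4: pad the derived family with `Ω` to a quadruple and use comb H-MIX(4)
    have hm4' : m ≤ 4 := by omega
    let W4 : Fin 4 → Set (Set ι) := fun a => if h : a.val < m then ⋂ l ∈ K ⟨a.val, h⟩, U l else Set.univ
    have hW4 : ∀ a : Fin 4, W4 a = ⋂ l ∈ (if h : a.val < m then K ⟨a.val, h⟩ else ∅), U l := fun a => by
      by_cases h : a.val < m
      · simp [W4, h]
      · simp [W4, h]
    have hW4her : CombHereditary W4 := hU.of_eq_biInter _ hW4
    have hW4up : ∀ a, IsUpperSet (W4 a) := fun a => by rw [hW4 a]; exact isUpperSet_biInter hUup _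
    have hW4e : ∀ (a : Fin 4) (b : Bool), secAt e b (W4 a) = W4 a := fun a b => by rw [hW4 a]; exact hsec _ b
    have H := combHereditary_orCoord_four W4 e (fun _ => true) hW4up hW4e hW4her
    refine (H m (fun j => ({Fin.castLE hm4' j} : Finset (Fin 4)))).congr fun p => ?_
    congr 1
    funext j
    rw [Finset.set_biInter_singleton, orCoord_all_apply, orCoord_all_apply]
    have hj : W4 (Fin.castLE hm4' j) = ⋂ l ∈ K j, U l := by
      have hlt : (Fin.castLE hm4' j).val < m := by simp
      simp only [W4, dif_pos hlt]
      rfl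
    rw [hj]
  · -- m = 5: singleton slots, the top row: comb TOP(5)
    obtain rfl : m = 5 := le_antisymm hm hm5
    obtain ⟨σ, hσ⟩ := exists_perm_of_irredundant hK
    have eW : (fun j => ind (orCoord (fun j => ⋂ l ∈ K j, U l) e (fun _ => true) j))
        = fun j => (fun l => ind (orCoord U e (fun _ => true) l)) (σ j) := by
      funext j
      show ind (orCoord (fun j => ⋂ l ∈ K j, U l) e (fun _ => true) j) = ind (orCoord U e (fun _ => true) (σ j))
      rw [orCoord_all_apply, orCoord_all_apply, hσ j, Finset.set_biInter_singleton]
    rw [show (fun p => sahiE (bernoulliWeight p) 5 (fun j => ind (orCoord (fun j => ⋂ l ∈ K j, U l) e (fun _ => true) j)))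
        = fun p => sahiE (bernoulliWeight p) 5 (fun j => (fun l => ind (orCoord U e (fun _ => true) l)) (σ j)) from by rw [eW]]
    refine (combPos_five_orCoord_all U e hUe hU).congr fun p => ?_
    rw [sahiE_comp_perm (bernoulliWeight p) 5 σ (fun l => ind (orCoord U e (fun _ => true) l))]

/-- Law-level shadow: for every product measure, the all-OR-ed quintuple is hereditarily all-orders positive. [this work] -/
theorem hereditaryAllOrders_orCoord_five_all (U : Fin 5 → Set (Set ι)) (e : ι)
    (hUup : ∀ j, IsUpperSet (U j)) (hUe : ∀ (j : Fin 5) (b : Bool), secAt e b (U j) = U j) (hU : CombHereditary U) (p : ι → unitInterval) :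
    SahiMixture.HereditaryAllOrders (bernoulliWeight p) (orCoord U e (fun _ => true)) :=
  (combHereditary_orCoord_five_all U e hUup hUe hU).hereditaryAllOrders p

/-- In particular every row `E_m(μ_p; ⋂_{K_1}(U_l ∪ {e∈ω}), …)` of the all-OR-ed quintuple is nonnegative under every product measure. [this work] -/
theorem sahiE_orCoord_five_all_row_nonneg (U : Fin 5 → Set (Set ι)) (e : ι)
    (hUup : ∀ j, IsUpperSet (U j)) (hUe : ∀ (j : Fin 5) (b : Bool), secAt e b (U j) = U j) (hU : CombHereditary U)
    (p : ι → unitInterval) (m : ℕ) (K : Fin m → Finset (Fin 5)) :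
    0 ≤ sahiE (bernoulliWeight p) m (fun j => ind (⋂ l ∈ K j, orCoord U e (fun _ => true) l)) :=
  ((combHereditary_orCoord_five_all U e hUup hUe hU) m K).nonneg p

end AllFive

end SahiCombMix

end Summit.CriticalPhenomena.PercolationContinuityZ3.Theorems

end
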